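import Summits.QuantumFields.YangMills.Theorems.FluctuationComparisonRegPrIntLBackgroundFormOfPolymerPackage
import HarnessLib

/-!
# BGFORM∘ v2 (coarse cells ∕ cell map) FROM POLY∘ — the cell-form background row is implied by the polymer form (texts inline, def-free)

Cell `ym3-torus` (YM ladder rung R3 = continuum `SU(2)` Yang–Mills on the three-torus — a RUNG, NOT d = 4, NOT infinite volume, NOT a mass gap,
NOT Clay).  Crux of record `stmt-QuantumFields-20520` = `UnitScaleTilt.FluctuationComparisonRegPrIntL` (DECIDING); this file is a HELPER
(`--supports`), it closes nothing and registers nothing (★★OWNER RULING №36: organ-level lines are published, not registered).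

WHAT.  LINE g24-4 «background form» v2 (ideator `ym-r3-idea-1` g24, P1 of critic #496 repaired in types) re-types the row BGFORM∘
`FluctuationBackgroundFormCan`: the terms `T X` are indexed by COARSE cells `X : Finset (PBond (F.P J) 0)`, the registers of the background map `M` stay on the
FINE bonds `PBond (F.P K) 0`, a CELL MAP `blk : PBond (F.P K) 0 → PBond (F.P J) 0` assigns fine bonds to coarse cells, the pseudo-metric `d` and every count
(`Σ_{c′} e^{−μd(c,c′)} ≤ C`, one-pin `≤ A`, two-pin `≤ Hc e^{−2μd}`) live on the COARSE lattice, the Lipschitz ∕ C¹·¹ clauses are in CELL-SUM form, and the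
responses are per fine bond with decay in the coarse distance of `blk e`.  §1 is the abstract ENCODING of an exactly-local polymer package (POLY∘'s data for one
window) in that currency — the v2 twin of ✓`…BackgroundFormOfPolymerPackage.backgroundForm_package`, simpler because no off-image metric is needed: the coarse
pseudo-metric is `(κ∕4)·t` itself; §2 docks it on the two row TEXTS (POLY∘ v2 = the binder `hP` of ✓`…PolymerNormKnit.fluctuationPartSmall_of_polymer`;
BGFORM∘ v2 VERBATIM).

DEGENERATE BY DESIGN (as (J) ✓`…BackgroundFormOfPolymer`): `h := 0`, ONE global LINEAR readout term `T′ univ`, registers := bond-distributed TERM VALUES placed at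
an injective anchor `π` of the coarse bonds in the fine bonds, `blk` := a left inverse of `π`; all locality and all decay are carried by the RESPONSE clauses.
Information about the ROW (BGFORM∘ v2 is weaker than POLY∘ v2 — the card's «not formalised» sentence made kernel), not about print.
Nothing here asserts POLY∘, BGFORM∘, S2β, GRAD∘, `FluctuationComparisonRegPrIntL` (20520) or `YM3TorusSU2`; no Literature fact is used or restated; rung R3 =
SU(2) YM₃ on T³ — NOT d = 4, NOT infinite volume, NOT a mass gap, NOT Clay.
-/

set_option autoImplicit false

noncomputable section

namespace Summit.QuantumFields.YangMills.Theorems.FluctuationComparisonRegPrIntLBackgroundFormCellOfPolymer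

open MeasureTheory Filter Topology Set
open scoped BigOperators
open Literature.MathematicalPhysics.QuantumFieldTheory.Balaban1983to89
open Literature.MathematicalPhysics.QuantumFieldTheory.Balaban1983to89.T3ContinuumYM3Torus
open Literature.MathematicalPhysics.QuantumFieldTheory.Balaban1983to89.T3NestedUnitLaws
open Literature.MathematicalPhysics.QuantumFieldTheory.Balaban1983to89.T3UnitLawDensityEML
open Literature.MathematicalPhysics.QuantumFieldTheory.Balaban1983to89.T3UnitScaleTilt
open Literature.MathematicalPhysics.QuantumFieldTheory.Balaban1983to89.T3TiltDescent
open Literature.MathematicalPhysics.QuantumFieldTheory.Balaban1983to89.T3PrintedRegularMinimiser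
open Literature.MathematicalPhysics.QuantumFieldTheory.Balaban1983to89.T3LevelShift
open Literature.MathematicalPhysics.QuantumFieldTheory.Balaban1983to89.Missing
open Literature.MathematicalPhysics.QuantumFieldTheory.Balaban1983to89.T4Continuum
open Literature.MathematicalPhysics.QuantumFieldTheory.Balaban1983to89.B12Decay510Torus (pl1 pl1_sub_comm pl1_sub_triangle)
open Literature.MathematicalPhysics.QuantumFieldTheory.Balaban1983to89.B12Decay510Window (K₁ K₁_nonneg)
open Summit.QuantumFields.YangMills.Theorems.FluctuationComparisonRegPrIntLPolymerTreeKnit (exists_siteEquiv_pl1)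
open Summit.QuantumFields.YangMills.Theorems.FluctuationComparisonRegPrIntLBackgroundFormOfPolymerPackage
  (abs_sum_apply_sub_le abs_sum_apply_sub_sub_add_le le_mul_exp_half_add sum_bond_exp_neg_tdist_le)

/-! ## §1 The cell-form encoding for one window (abstract) -/

/-- **The cell-form background package of an exactly-local polymer package** (one window; abstract in the coarse-bond type `β`, the fine-bond type `E`, the
window set `S ⊆ (β → G)` and the value type `G`).  DATA: a pseudo-metric `t` on `β`; an injection `π : β → E`; terms `T X` exactly local in the field on `X` (i)
with one-bond oscillation moduli `w X` (ii) whose two-pin sums are `≤ φ e^{−κ t}` (iv).  OUTPUT: a cell map `blk : E → β` with `blk ∘ π = id`; the background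
map `M U (π c) := (Σ_{X ∋ c} T X U ∕ #X)·𝟙` (`0` off `range π`); the single linear readout term `T′ univ m := Σ_c (m (π c)) 0` (`0` on `X ≠ univ`) which is
CELL-SUM Lipschitz with modulus `𝟙[X = univ]` and has cell-sum second differences bounded by the readout of the second difference (moduli `h := 0`); the
one-bond response `≤ φ e^{−2·1·(κ∕4)t(b, blk e)}` and the mixed two-bond response `≤ 2φ e^{−2·1·(κ∕4)t(b, blk e)} e^{−2·1·(κ∕4)t(blk e, b′)}` at every fine
bond (POLY∘'s pinned sums after exact locality; `0` off `range π`); and the resummation `Σ_X T′ X (M U) = Σ_X T X U − T ∅ U`. [folklore] -/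
theorem backgroundFormCell_package {β E G : Type*} [Fintype β] [DecidableEq β] [Nonempty β] [Fintype E] [DecidableEq E]
    (S : Set (β → G)) (t : β → β → ℝ) (ht0 : ∀ b b', 0 ≤ t b b') (htsymm : ∀ b b', t b b' = t b' b)
    (π : β → E) (hπ : Function.Injective π)
    (T : Finset β → (β → G) → ℝ) (w : Finset β → ℝ) {κ φ : ℝ} (hκ : 0 < κ) (hφ : 0 ≤ φ)
    (hi : ∀ (X : Finset β) (U V : β → G), (∀ e ∈ X, U e = V e) → T X U = T X V)
    (hii : ∀ (X : Finset β) (b : β) (U V : β → G), U ∈ S → V ∈ S → (∀ e, e ≠ b → U e = V e) → |T X U - T X V| ≤ w X)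
    (hiv : ∀ b b' : β, ∑ X ∈ Finset.univ.filter (fun X => b ∈ X ∧ b' ∈ X), w X ≤ φ * Real.exp (-(κ * t b b'))) :
    ∃ (blk : E → β) (M : (β → G) → E → (Fin 8 → ℝ)) (T' : Finset β → (E → (Fin 8 → ℝ)) → ℝ),
      (∀ b, blk (π b) = b) ∧
      (∀ (X : Finset β) (m m' : E → (Fin 8 → ℝ)) (Sc : β → ℝ),
          (∀ e, blk e ∈ X → ‖m e - m' e‖ ≤ Sc (blk e)) →
          |T' X m - T' X m'| ≤ (if X = Finset.univ then (1 : ℝ) else 0) * ∑ c ∈ X, Sc c) ∧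
      (∀ (X : Finset β) (m₁ m₂ m₃ m₄ : E → (Fin 8 → ℝ)) (Sc : β → ℝ),
          (∀ e, blk e ∈ X → ‖m₁ e - m₂ e - m₃ e + m₄ e‖ ≤ Sc (blk e)) →
          |T' X m₁ - T' X m₂ - T' X m₃ + T' X m₄| ≤ (if X = Finset.univ then (1 : ℝ) else 0) * ∑ c ∈ X, Sc c) ∧
      (∀ (b : β) (U V : β → G), U ∈ S → V ∈ S → (∀ e, e ≠ b → U e = V e) →
          ∀ e, ‖M U e - M V e‖ ≤ φ * Real.exp (-(2 * 1 * (κ / 4 * t b (blk e))))) ∧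
      (∀ (b b' : β) (U V W Z : β → G), U ∈ S → V ∈ S → W ∈ S → Z ∈ S →
          (∀ e, e ≠ b → U e = V e) → (∀ e, e ≠ b' → U e = W e) → (∀ e, e ≠ b' → V e = Z e) → (∀ e, e ≠ b → W e = Z e) →
          ∀ e, ‖M U e - M W e - M V e + M Z e‖ ≤
            2 * φ * (Real.exp (-(2 * 1 * (κ / 4 * t b (blk e)))) * Real.exp (-(2 * 1 * (κ / 4 * t (blk e) b'))))) ∧
      (∀ U : β → G, ∑ X, T' X (M U) = ∑ X, T X U - T ∅ U) := by
  classical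
  -- the bond-distributed term values
  set f : β → (β → G) → ℝ := fun b U => ∑ X ∈ Finset.univ.filter (fun X => b ∈ X), T X U / (X.card : ℝ) with hf
  set M : (β → G) → E → (Fin 8 → ℝ) := fun U e _ => ∑ b ∈ Finset.univ.filter (fun b => π b = e), f b U with hM
  set T' : Finset β → (E → (Fin 8 → ℝ)) → ℝ := fun X m => if X = Finset.univ then ∑ c, m (π c) 0 else 0 with hT'
  set blk : E → β := Function.invFun π with hblk
  have hinv : ∀ b, blk (π b) = b := fun b => Function.leftInverse_invFun hπ b
  -- fibre of the anchor
  have hfib : ∀ b, Finset.univ.filter (fun b' => π b' = π b) = {b} := by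
    intro b; ext b'; simp [hπ.eq_iff]
  have hfib0 : ∀ e, e ∉ Set.range π → Finset.univ.filter (fun b' => π b' = e) = ∅ := by
    intro e he
    ext b'
    simp only [Finset.mem_filter, Finset.mem_univ, true_and, Finset.notMem_empty, iff_false]
    exact fun h => he ⟨b', h⟩
  have hMπ : ∀ U b, M U (π b) = fun _ => f b U := by
    intro U b; funext i; simp only [hM, hfib, Finset.sum_singleton]
  have hMoff : ∀ U e, e ∉ Set.range π → M U e = 0 := by
    intro U e he; funext i; simp only [hM, hfib0 e he, Finset.sum_empty, Pi.zero_apply]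
  -- nonnegativity of the moduli on a nonempty window
  have hw : ∀ U, U ∈ S → ∀ X, 0 ≤ w X := fun U hU X =>
    (abs_nonneg _).trans (hii X (Classical.arbitrary β) U U hU hU fun _ _ => rfl)
  -- one-bond move: the distributed values at b'' move by at most the (b, b'')-pinned sum
  have hR1 : ∀ (b : β) (U V : β → G), U ∈ S → V ∈ S → (∀ e, e ≠ b → U e = V e) →
      ∀ b'', |f b'' U - f b'' V| ≤ ∑ X ∈ Finset.univ.filter (fun X => b'' ∈ X ∧ b ∈ X), w X := by
    intro b U V hU hV hUV b''
    have h1 : f b'' U - f b'' V = ∑ X ∈ Finset.univ.filter (fun X => b'' ∈ X), (T X U - T X V) / (X.card : ℝ) := by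
      simp only [hf, ← Finset.sum_sub_distrib, sub_div]
    rw [h1]
    refine (Finset.abs_sum_le_sum_abs _ _).trans ?_
    have h2 : ∀ X ∈ Finset.univ.filter (fun X => b'' ∈ X), |(T X U - T X V) / (X.card : ℝ)| ≤ if b ∈ X then w X else 0 := by
      intro X hX
      have hXne : X.Nonempty := ⟨b'', (Finset.mem_filter.mp hX).2⟩
      have hc : (1 : ℝ) ≤ X.card := by exact_mod_cast hXne.card_pos
      rw [abs_div, abs_of_pos (by positivity : (0 : ℝ) < X.card)]
      refine (div_le_self (abs_nonneg _) hc).trans ?_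
      split_ifs with hb
      · exact hii X b U V hU hV hUV
      · rw [hi X U V fun e he => hUV e fun h => hb (h ▸ he), sub_self, abs_zero]
    refine (Finset.sum_le_sum h2).trans (le_of_eq ?_)
    rw [← Finset.sum_filter, Finset.filter_filter]
  -- the square: the distributed values at b'' have mixed differences bounded by twice the (b, b', b'')-pinned sum
  have hR2 : ∀ (b b' : β) (U V W Z : β → G), U ∈ S → V ∈ S → W ∈ S → Z ∈ S →
      (∀ e, e ≠ b → U e = V e) → (∀ e, e ≠ b' → U e = W e) → (∀ e, e ≠ b' → V e = Z e) → (∀ e, e ≠ b → W e = Z e) →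
      ∀ b'', |f b'' U - f b'' W - f b'' V + f b'' Z| ≤
        2 * ∑ X ∈ Finset.univ.filter (fun X => b'' ∈ X ∧ (b ∈ X ∧ b' ∈ X)), w X := by
    intro b b' U V W Z hU hV hW hZ hUV hUW hVZ hWZ b''
    have h1 : f b'' U - f b'' W - f b'' V + f b'' Z =
        ∑ X ∈ Finset.univ.filter (fun X => b'' ∈ X), (T X U - T X W - T X V + T X Z) / (X.card : ℝ) := by
      simp only [hf, ← Finset.sum_sub_distrib, ← Finset.sum_add_distrib]
      refine Finset.sum_congr rfl fun X _ => ?_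
      ring
    rw [h1]
    refine (Finset.abs_sum_le_sum_abs _ _).trans ?_
    have h2 : ∀ X ∈ Finset.univ.filter (fun X => b'' ∈ X),
        |(T X U - T X W - T X V + T X Z) / (X.card : ℝ)| ≤ if b ∈ X ∧ b' ∈ X then 2 * w X else 0 := by
      intro X hX
      have hXne : X.Nonempty := ⟨b'', (Finset.mem_filter.mp hX).2⟩
      have hc : (1 : ℝ) ≤ X.card := by exact_mod_cast hXne.card_pos
      rw [abs_div, abs_of_pos (by positivity : (0 : ℝ) < X.card)]
      refine (div_le_self (abs_nonneg _) hc).trans ?_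
      split_ifs with hb
      · have hA : |T X U - T X W| ≤ w X := hii X b' U W hU hW hUW
        have hB : |T X V - T X Z| ≤ w X := hii X b' V Z hV hZ hVZ
        calc |T X U - T X W - T X V + T X Z| = |(T X U - T X W) - (T X V - T X Z)| := by ring_nf
          _ ≤ |T X U - T X W| + |T X V - T X Z| := abs_sub _ _
          _ ≤ 2 * w X := by linarith
      · rcases not_and_or.mp hb with hb₁ | hb₂
        · rw [hi X U V fun e he => hUV e fun h => hb₁ (h ▸ he), hi X W Z fun e he => hWZ e fun h => hb₁ (h ▸ he)]
          rw [show T X V - T X Z - T X V + T X Z = 0 by ring, abs_zero]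
        · rw [hi X U W fun e he => hUW e fun h => hb₂ (h ▸ he), hi X V Z fun e he => hVZ e fun h => hb₂ (h ▸ he)]
          rw [show T X W - T X W - T X Z + T X Z = 0 by ring, abs_zero]
    refine (Finset.sum_le_sum h2).trans (le_of_eq ?_)
    rw [← Finset.sum_filter, Finset.filter_filter, Finset.mul_sum]
  refine ⟨blk, M, T', hinv, ?_, ?_, ?_, ?_, ?_⟩
  · -- cell-sum Lipschitz of the readout
    intro X m m' Sc hS
    by_cases hX : X = Finset.univ
    · subst hX
      simp only [hT', if_true, one_mul]
      refine (abs_sum_apply_sub_le Finset.univ (fun c => m (π c)) (fun c => m' (π c))).trans ?_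
      exact Finset.sum_le_sum fun c _ => by simpa [hinv] using hS (π c) (by simp [hinv])
    · simp [hT', hX]
  · -- cell-sum second differences of the readout
    intro X m₁ m₂ m₃ m₄ Sc hS
    by_cases hX : X = Finset.univ
    · subst hX
      simp only [hT', if_true, one_mul]
      refine (abs_sum_apply_sub_sub_add_le Finset.univ (fun c => m₁ (π c)) (fun c => m₂ (π c)) (fun c => m₃ (π c))
        (fun c => m₄ (π c))).trans ?_
      exact Finset.sum_le_sum fun c _ => by simpa [hinv] using hS (π c) (by simp [hinv])
    · simp [hT', hX]
  · -- one-bond response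
    intro b U V hU hV hUV e
    by_cases he : e ∈ Set.range π
    · obtain ⟨b'', rfl⟩ := he
      rw [hMπ, hMπ, hinv]
      have h1 : ‖(fun _ : Fin 8 => f b'' U) - (fun _ : Fin 8 => f b'' V)‖ = |f b'' U - f b'' V| := by
        rw [show ((fun _ : Fin 8 => f b'' U) - fun _ : Fin 8 => f b'' V) = fun _ => f b'' U - f b'' V from rfl,
          pi_norm_const, Real.norm_eq_abs]
      rw [h1]
      refine (hR1 b U V hU hV hUV b'').trans ?_
      have h2 := hiv b'' b
      rw [htsymm] at h2
      refine h2.trans (mul_le_mul_of_nonneg_left (Real.exp_le_exp.mpr ?_) hφ)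
      nlinarith [mul_nonneg hκ.le (ht0 b b'')]
    · rw [hMoff U e he, hMoff V e he, sub_zero, norm_zero]
      positivity
  · -- mixed two-bond response
    intro b b' U V W Z hU hV hW hZ hUV hUW hVZ hWZ e
    by_cases he : e ∈ Set.range π
    · obtain ⟨b'', rfl⟩ := he
      rw [hMπ, hMπ, hMπ, hMπ, hinv]
      have h1 : ‖(fun _ : Fin 8 => f b'' U) - (fun _ : Fin 8 => f b'' W) - (fun _ : Fin 8 => f b'' V) + (fun _ : Fin 8 => f b'' Z)‖ =
          |f b'' U - f b'' W - f b'' V + f b'' Z| := by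
        rw [show ((fun _ : Fin 8 => f b'' U) - (fun _ : Fin 8 => f b'' W) - (fun _ : Fin 8 => f b'' V) + fun _ : Fin 8 => f b'' Z) =
            fun _ => f b'' U - f b'' W - f b'' V + f b'' Z from rfl, pi_norm_const, Real.norm_eq_abs]
      rw [h1]
      have hw' := hw U hU
      have h3 := hR2 b b' U V W Z hU hV hW hZ hUV hUW hVZ hWZ b''
      have hS1 : ∑ X ∈ Finset.univ.filter (fun X => b'' ∈ X ∧ (b ∈ X ∧ b' ∈ X)), w X ≤ φ * Real.exp (-(κ * t b b'')) := by
        have h2 := hiv b'' b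
        rw [htsymm] at h2
        refine le_trans (Finset.sum_le_sum_of_subset_of_nonneg ?_ fun X _ _ => hw' X) h2
        intro X; simp only [Finset.mem_filter, Finset.mem_univ, true_and]; tauto
      have hS2 : ∑ X ∈ Finset.univ.filter (fun X => b'' ∈ X ∧ (b ∈ X ∧ b' ∈ X)), w X ≤ φ * Real.exp (-(κ * t b'' b')) := by
        refine le_trans (Finset.sum_le_sum_of_subset_of_nonneg ?_ fun X _ _ => hw' X) (hiv b'' b')
        intro X; simp only [Finset.mem_filter, Finset.mem_univ, true_and]; tauto
      have h4 := le_mul_exp_half_add hφ hκ.le hS1 hS2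
      linarith
    · rw [hMoff U e he, hMoff V e he, hMoff W e he, hMoff Z e he, sub_zero, sub_zero, add_zero, norm_zero]
      positivity
  · -- resummation
    intro U
    have h1 : ∑ X, T' X (M U) = T' Finset.univ (M U) := by
      rw [Finset.sum_eq_single Finset.univ (fun X _ hX => by simp [hT', hX]) (fun h => (h (Finset.mem_univ _)).elim)]
    have h2 : T' Finset.univ (M U) = ∑ b, f b U := by simp only [hT', if_true, hMπ]
    have h3 : ∑ b, f b U = ∑ X : Finset β, (X.card : ℝ) * (T X U / (X.card : ℝ)) := by
      simp only [hf]
      rw [show (∑ b : β, ∑ X ∈ Finset.univ.filter (fun X => b ∈ X), T X U / (X.card : ℝ)) =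
          ∑ b : β, ∑ X : Finset β, if b ∈ X then T X U / (X.card : ℝ) else 0 from
          Finset.sum_congr rfl fun b _ => Finset.sum_filter _ _, Finset.sum_comm]
      refine Finset.sum_congr rfl fun X _ => ?_
      rw [Finset.sum_ite_mem, Finset.univ_inter, Finset.sum_const, nsmul_eq_mul]
    have h4 : ∑ X : Finset β, (X.card : ℝ) * (T X U / (X.card : ℝ)) = ∑ X, T X U - T ∅ U := by
      rw [← Finset.add_sum_erase Finset.univ _ (Finset.mem_univ ∅), ← Finset.add_sum_erase Finset.univ (fun X => T X U) (Finset.mem_univ ∅)]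
      rw [Finset.card_empty, Nat.cast_zero, zero_mul, zero_add, add_sub_cancel_left]
      refine Finset.sum_congr rfl fun X hX => ?_
      have hX' : X ≠ ∅ := Finset.ne_of_mem_erase hX
      have hc : (X.card : ℝ) ≠ 0 := by exact_mod_cast (Finset.nonempty_iff_ne_empty.mpr hX').card_pos.ne'
      rw [mul_div_cancel₀ _ hc]
    rw [h1, h2, h3, h4]

/-! ## §2 ★ BGFORM∘ v2 from POLY∘ -/

/-- ★ **BGFORM∘ v2 ⟸ POLY∘**: the cell-form background row `FluctuationBackgroundFormCan` of LINE g24-4 **v2** (`Cruxes/FluctuationComparisonRegPrIntL/Lines/background_form.lean`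
22880983c54704f6 §1, VERBATIM as the conclusion; = the binder `hB` of `…BackgroundFormCellKnit.fluctuationPartSmall_of_backgroundFormCell`) follows from the
polymer-form row `FluctuationPolymerCan` of LINE g24-3 (`…/Lines/polymer_form.lean` §1 v2, VERBATIM as the binder `hP`; = the binder of
✓`…PolymerNormKnit.fluctuationPartSmall_of_polymer`).  Frame passed through; constants `κ_BG := κ∕4`, `μ := 1`, `C := 3·K₁(3,κ∕4)`, `A := 1`, `Hc := 0`; moduli
`σ := φ`, `σ₂ := 2φ`; per window: `c₀′ := c₀ + T ∅ U₀`, the COARSE pseudo-metric `d := (κ∕4)·tdist_J` of bond sources (symmetric ∕ triangle through the isometry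
✓`exists_siteEquiv_pl1`; uniform sums by ✓`sum_bond_exp_neg_tdist_le`), and the cell package `backgroundFormCell_package` at the val-cast anchor
`π b := (val-cast of b.src into ZMod (2L^{m+K}), b.dir)` (injective since `2L^{m+J} ≤ 2L^{m+K}`): `blk` := a left inverse of `π`, registers := bond-distributed
term values at `π c`, ONE linear readout term, `ℓ := 𝟙[X = univ]`, `h := 0`.  Problem-relative: a junction between two HYPOTHESIS rows; neither is asserted;
S2β ∕ 20520 ∕ `YM3TorusSU2` are not touched; rung R3 — NOT d = 4, NOT infinite volume, NOT a mass gap, NOT Clay.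
[cite: Balaban1987RG1, (0.22)-(0.25) pp.256-257 and (5.10) p.293; Balaban1985Variational, Prop. 9 p.309, (182)-(190) pp.307-308] -/
theorem backgroundFormCell_of_polymer
    (hP : ∀ (L : ℕ), ∃ pS : ℝ, ∀ (b₀ p₀ : ℝ), 0 < b₀ → pS ≤ p₀ → 0 < p₀ → ∃ ε₁ : ℝ, 0 < ε₁ ∧ ∀ (ε₀ : ℝ), 0 < ε₀ → ε₀ ≤ ε₁ →
      ∃ γ₁ : ℝ, 0 < γ₁ ∧ ∃ κ : ℝ, 0 < κ ∧ ∀ (F : T3Family) (γ : ℝ), F.L = L → 0 < γ → γ ≤ γ₁ →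
        ∃ (φ : ℕ → ℝ), (∀ J, 0 ≤ φ J) ∧ (∀ a : ℕ, Tendsto (fun J : ℕ => ((J : ℝ) + 1) ^ a * φ J) atTop (𝓝 0)) ∧
          ∀ (ν : ℕ → (j : ℕ) → Measure (GaugeField (F.P j) 0 (Matrix.specialUnitaryGroup (Fin 2) ℂ))),
            (∀ K, ν K K = T4GenFunBounds.gibbsMeasure (F.P K) ((F.scheme ℰp γ).β K)) →
            (∀ K j, j < K → ν K j = Measure.map (descend F ℰp j) (ν K (j + 1))) →
            ∀ (J K : ℕ) (hJK : J ≤ K) (ρ : GaugeField (F.P J) 0 (Matrix.specialUnitaryGroup (Fin 2) ℂ) → ℝ),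
              (∀ U, PlaqSmall (θBal F.L γ b₀ p₀ J) U → 0 < ρ U) →
              ν K J = (fieldMeasure _ _ _).withDensity (fun U => ENNReal.ofReal (ρ U)) →
              ContinuousOn ρ {U | PlaqSmall (θBal F.L γ b₀ p₀ J) U} →
              ∃ (c₀ : ℝ) (T : Finset (PBond (F.P J) 0) → GaugeField (F.P J) 0 (Matrix.specialUnitaryGroup (Fin 2) ℂ) → ℝ)
                (w : Finset (PBond (F.P J) 0) → ℝ),
                (∀ (X : Finset (PBond (F.P J) 0)) (U V : GaugeField (F.P J) 0 (Matrix.specialUnitaryGroup (Fin 2) ℂ)),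
                    (∀ e ∈ X, U e = V e) → T X U = T X V) ∧
                (∀ (X : Finset (PBond (F.P J) 0)) (b : PBond (F.P J) 0) (U V : GaugeField (F.P J) 0 (Matrix.specialUnitaryGroup (Fin 2) ℂ)),
                    PlaqSmall (θBal F.L γ b₀ p₀ J) U → PlaqSmall (θBal F.L γ b₀ p₀ J) V → (∀ e, e ≠ b → U e = V e) → |T X U - T X V| ≤ w X) ∧
                (∀ b : PBond (F.P J) 0, ∑ X ∈ Finset.univ.filter (fun X => b ∈ X), w X ≤ φ J) ∧
                (∀ b b' : PBond (F.P J) 0,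
                    ∑ X ∈ Finset.univ.filter (fun X => b ∈ X ∧ b' ∈ X), w X ≤ φ J * Real.exp (-(κ * (b.src.tdist b'.src : ℝ)))) ∧
                (∀ U : GaugeField (F.P J) 0 (Matrix.specialUnitaryGroup (Fin 2) ℂ), PlaqSmall (θBal F.L γ b₀ p₀ J) U →
                    Real.log (ρ U) + (F.scheme ℰp γ).β K * minActionRegPr F J K hJK ε₀ U = c₀ + ∑ X, T X U)) :
  ∀ (L : ℕ), ∃ pS : ℝ, ∀ (b₀ p₀ : ℝ), 0 < b₀ → pS ≤ p₀ → 0 < p₀ → ∃ ε₁ : ℝ, 0 < ε₁ ∧ ∀ (ε₀ : ℝ), 0 < ε₀ → ε₀ ≤ ε₁ →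
    ∃ γ₁ : ℝ, 0 < γ₁ ∧ ∃ (κ μ C A Hc : ℝ), 0 < κ ∧ 0 ≤ μ ∧ 0 ≤ A ∧ 0 ≤ Hc ∧ ∀ (F : T3Family) (γ : ℝ), F.L = L → 0 < γ → γ ≤ γ₁ →
      ∃ (σ σ₂ : ℕ → ℝ), (∀ J, 0 ≤ σ J) ∧ (∀ J, 0 ≤ σ₂ J) ∧
        (∀ a : ℕ, Tendsto (fun J : ℕ => ((J : ℝ) + 1) ^ a * σ J) atTop (𝓝 0)) ∧
        (∀ a : ℕ, Tendsto (fun J : ℕ => ((J : ℝ) + 1) ^ a * σ₂ J) atTop (𝓝 0)) ∧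
        ∀ (ν : ℕ → (j : ℕ) → Measure (GaugeField (F.P j) 0 (Matrix.specialUnitaryGroup (Fin 2) ℂ))),
          (∀ K, ν K K = T4GenFunBounds.gibbsMeasure (F.P K) ((F.scheme ℰp γ).β K)) →
          (∀ K j, j < K → ν K j = Measure.map (descend F ℰp j) (ν K (j + 1))) →
          ∀ (J K : ℕ) (hJK : J ≤ K) (ρ : GaugeField (F.P J) 0 (Matrix.specialUnitaryGroup (Fin 2) ℂ) → ℝ),
            (∀ U, PlaqSmall (θBal F.L γ b₀ p₀ J) U → 0 < ρ U) →
            ν K J = (fieldMeasure _ _ _).withDensity (fun U => ENNReal.ofReal (ρ U)) →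
            ContinuousOn ρ {U | PlaqSmall (θBal F.L γ b₀ p₀ J) U} →
            ∃ (c₀ : ℝ) (d : PBond (F.P J) 0 → PBond (F.P J) 0 → ℝ) (blk : PBond (F.P K) 0 → PBond (F.P J) 0)
              (M : GaugeField (F.P J) 0 (Matrix.specialUnitaryGroup (Fin 2) ℂ) → PBond (F.P K) 0 → (Fin 8 → ℝ))
              (T : Finset (PBond (F.P J) 0) → (PBond (F.P K) 0 → (Fin 8 → ℝ)) → ℝ)
              (ℓ h : Finset (PBond (F.P J) 0) → ℝ),
              (∀ x y, 0 ≤ d x y) ∧ (∀ x y, d x y = d y x) ∧ (∀ x y z, d x z ≤ d x y + d y z) ∧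
              (∀ x, ∑ y, Real.exp (-(μ * d x y)) ≤ C) ∧
              (∀ b b' : PBond (F.P J) 0, κ * (b.src.tdist b'.src : ℝ) ≤ μ * d b b') ∧
              (∀ X, 0 ≤ ℓ X) ∧ (∀ X, 0 ≤ h X) ∧
              (∀ c, ∑ X ∈ Finset.univ.filter (fun X => c ∈ X), ℓ X ≤ A) ∧
              (∀ c c', ∑ X ∈ Finset.univ.filter (fun X => c ∈ X ∧ c' ∈ X), h X ≤ Hc * Real.exp (-(2 * μ * d c c'))) ∧
              (∀ (X : Finset (PBond (F.P J) 0)) (U V : GaugeField (F.P J) 0 (Matrix.specialUnitaryGroup (Fin 2) ℂ)),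
                  PlaqSmall (θBal F.L γ b₀ p₀ J) U → PlaqSmall (θBal F.L γ b₀ p₀ J) V →
                  ∀ (S₁ : PBond (F.P J) 0 → ℝ), (∀ c, 0 ≤ S₁ c) →
                  (∀ e, blk e ∈ X → ‖M U e - M V e‖ ≤ S₁ (blk e)) →
                  |T X (M U) - T X (M V)| ≤ ℓ X * ∑ c ∈ X, S₁ c) ∧
              (∀ (X : Finset (PBond (F.P J) 0)) (U V W Z : GaugeField (F.P J) 0 (Matrix.specialUnitaryGroup (Fin 2) ℂ)),
                  PlaqSmall (θBal F.L γ b₀ p₀ J) U → PlaqSmall (θBal F.L γ b₀ p₀ J) V →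
                  PlaqSmall (θBal F.L γ b₀ p₀ J) W → PlaqSmall (θBal F.L γ b₀ p₀ J) Z →
                  ∀ (S₁ S₂ S₁₂ : PBond (F.P J) 0 → ℝ), (∀ c, 0 ≤ S₁ c) → (∀ c, 0 ≤ S₂ c) → (∀ c, 0 ≤ S₁₂ c) →
                  (∀ e, blk e ∈ X → ‖M W e - M Z e‖ ≤ S₁ (blk e)) →
                  (∀ e, blk e ∈ X → ‖M V e - M Z e‖ ≤ S₂ (blk e)) →
                  (∀ e, blk e ∈ X → ‖M U e - M W e - M V e + M Z e‖ ≤ S₁₂ (blk e)) →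
                  |T X (M U) - T X (M W) - T X (M V) + T X (M Z)| ≤
                    h X * (∑ c ∈ X, S₁ c) * (∑ c ∈ X, S₂ c) + ℓ X * ∑ c ∈ X, S₁₂ c) ∧
              (∀ (b : PBond (F.P J) 0) (U V : GaugeField (F.P J) 0 (Matrix.specialUnitaryGroup (Fin 2) ℂ)),
                  PlaqSmall (θBal F.L γ b₀ p₀ J) U → PlaqSmall (θBal F.L γ b₀ p₀ J) V → (∀ e, e ≠ b → U e = V e) →
                  ∀ e, ‖M U e - M V e‖ ≤ σ J * Real.exp (-(2 * μ * d b (blk e)))) ∧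
              (∀ (b b' : PBond (F.P J) 0) (U V W Z : GaugeField (F.P J) 0 (Matrix.specialUnitaryGroup (Fin 2) ℂ)),
                  PlaqSmall (θBal F.L γ b₀ p₀ J) U → PlaqSmall (θBal F.L γ b₀ p₀ J) V →
                  PlaqSmall (θBal F.L γ b₀ p₀ J) W → PlaqSmall (θBal F.L γ b₀ p₀ J) Z →
                  (∀ e, e ≠ b → U e = V e) → (∀ e, e ≠ b' → U e = W e) → (∀ e, e ≠ b' → V e = Z e) → (∀ e, e ≠ b → W e = Z e) →
                  ∀ e, ‖M U e - M W e - M V e + M Z e‖ ≤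
                    σ₂ J * (Real.exp (-(2 * μ * d b (blk e))) * Real.exp (-(2 * μ * d (blk e) b')))) ∧
              (∀ U : GaugeField (F.P J) 0 (Matrix.specialUnitaryGroup (Fin 2) ℂ), PlaqSmall (θBal F.L γ b₀ p₀ J) U →
                  Real.log (ρ U) + (F.scheme ℰp γ).β K * minActionRegPr F J K hJK ε₀ U = c₀ + ∑ X, T X (M U)) := by
  classical
  intro L
  obtain ⟨pS, hpS⟩ := hP L
  refine ⟨pS, fun b₀ p₀ hb₀ hpS₀ hp₀ => ?_⟩
  obtain ⟨ε₁, hε₁, hε⟩ := hpS b₀ p₀ hb₀ hpS₀ hp₀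
  refine ⟨ε₁, hε₁, fun ε₀ hε₀ hε₀₁ => ?_⟩
  obtain ⟨γ₁, hγ₁, κ, hκ, hF⟩ := hε ε₀ hε₀ hε₀₁
  refine ⟨γ₁, hγ₁, κ / 4, 1, 3 * K₁ 3 (κ / 4), 1, 0, by positivity, zero_le_one, zero_le_one, le_rfl, fun F γ hFL hγ hγ₁' => ?_⟩
  obtain ⟨φ, hφ0, hφsp, hν⟩ := hF F γ hFL hγ hγ₁'
  refine ⟨φ, fun J => 2 * φ J, hφ0, fun J => by have := hφ0 J; positivity, hφsp, fun a => ?_, fun ν hTop hCons J K hJK ρ hpos hdens hcont => ?_⟩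
  · have h := (hφsp a).const_mul 2
    rw [mul_zero] at h
    refine h.congr' (Eventually.of_forall fun J => ?_)
    simp only; ring
  obtain ⟨c₀, T, w, hi, hii, hiii, hiv, hv⟩ := hν ν hTop hCons J K hJK ρ hpos hdens hcont
  -- the anchor: val-cast of the source, same direction
  have hle : (F.P J).sitesPerDir 0 ≤ (F.P K).sitesPerDir 0 := by
    show 2 * F.L ^ (F.m + J - 0) ≤ 2 * F.L ^ (F.m + K - 0)
    have hL : 0 < F.L := by have := F.hL.2; omega
    exact Nat.mul_le_mul_left 2 (Nat.pow_le_pow_right hL (by omega))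
  let π : PBond (F.P J) 0 → PBond (F.P K) 0 := fun b =>
    ⟨fun μ => (((b.src μ).val : ℕ) : ZMod ((F.P K).sitesPerDir 0)), b.dir⟩
  have hπ : Function.Injective π := by
    intro b₁ b₂ h
    have hsrc0 : (π b₁).src = (π b₂).src := congrArg PBond.src h
    have hdir0 : (π b₁).dir = (π b₂).dir := congrArg PBond.dir h
    have hsrc : ∀ μ, (((b₁.src μ).val : ℕ) : ZMod ((F.P K).sitesPerDir 0)) = (((b₂.src μ).val : ℕ) : ZMod ((F.P K).sitesPerDir 0)) :=
      fun μ => congrFun hsrc0 μ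
    have hdir : b₁.dir = b₂.dir := hdir0
    have hs : b₁.src = b₂.src := by
      funext μ
      have h1 := congrArg ZMod.val (hsrc μ)
      rw [ZMod.val_natCast, ZMod.val_natCast, Nat.mod_eq_of_lt (lt_of_lt_of_le (ZMod.val_lt _) hle),
        Nat.mod_eq_of_lt (lt_of_lt_of_le (ZMod.val_lt _) hle)] at h1
      exact ZMod.val_injective _ h1
    cases b₁; cases b₂; simp only at hs hdir; subst hs; subst hdir; rfl
  -- the level-J bond pseudo-metric `(κ/4)·tdist`
  obtain ⟨e, -, he⟩ := exists_siteEquiv_pl1 F J (N := (F.P J).sitesPerDir 0) (M := 1) (by simp)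
  haveI : Nonempty (PBond (F.P J) 0) := ⟨⟨default, ⟨0, by rw [T3Family.P_d]; norm_num⟩⟩⟩
  have ht0 : ∀ b b' : PBond (F.P J) 0, (0 : ℝ) ≤ (b.src.tdist b'.src : ℝ) := fun b b' => Nat.cast_nonneg _
  have htsymm : ∀ b b' : PBond (F.P J) 0, (b.src.tdist b'.src : ℝ) = (b'.src.tdist b.src : ℝ) := fun b b' => by
    rw [he, he, pl1_sub_comm]
  have httri : ∀ b b' b'' : PBond (F.P J) 0, (b.src.tdist b''.src : ℝ) ≤ (b.src.tdist b'.src : ℝ) + (b'.src.tdist b''.src : ℝ) :=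
    fun b b' b'' => by rw [he, he, he]; exact pl1_sub_triangle _ _ _
  have hκ4 : (0 : ℝ) ≤ κ / 4 := by positivity
  obtain ⟨blk, M, T', hblk, hLip, hC11, hR1, hR2, hrep⟩ :=
    backgroundFormCell_package {U | PlaqSmall (θBal F.L γ b₀ p₀ J) U} (fun b b' : PBond (F.P J) 0 => (b.src.tdist b'.src : ℝ))
      ht0 htsymm π hπ T w hκ (hφ0 J) hi hii hiv
  -- the clauses about `d := (κ/4)·tdist_J`, `ℓ := 𝟙[X = univ]`, `h := 0`, stated beta-reduced
  have hd0 : ∀ x y : PBond (F.P J) 0, (0 : ℝ) ≤ κ / 4 * (x.src.tdist y.src : ℝ) := fun x y => mul_nonneg hκ4 (ht0 x y)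
  have hdsymm : ∀ x y : PBond (F.P J) 0, κ / 4 * (x.src.tdist y.src : ℝ) = κ / 4 * (y.src.tdist x.src : ℝ) := fun x y => by rw [htsymm]
  have hdtri : ∀ x y z : PBond (F.P J) 0,
      κ / 4 * (x.src.tdist z.src : ℝ) ≤ κ / 4 * (x.src.tdist y.src : ℝ) + κ / 4 * (y.src.tdist z.src : ℝ) := fun x y z => by
    rw [← mul_add]; exact mul_le_mul_of_nonneg_left (httri x y z) hκ4
  have hdsum : ∀ x : PBond (F.P J) 0, ∑ y : PBond (F.P J) 0, Real.exp (-(1 * (κ / 4 * (x.src.tdist y.src : ℝ)))) ≤ 3 * K₁ 3 (κ / 4) := fun x => by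
    simpa only [one_mul] using sum_bond_exp_neg_tdist_le F J (a := κ / 4) (by positivity) x
  have hdcmp : ∀ b b' : PBond (F.P J) 0, κ / 4 * (b.src.tdist b'.src : ℝ) ≤ 1 * (κ / 4 * (b.src.tdist b'.src : ℝ)) := fun b b' => by rw [one_mul]
  have hℓ0 : ∀ X : Finset (PBond (F.P J) 0), (0 : ℝ) ≤ (if X = Finset.univ then (1 : ℝ) else 0) := fun X => by split_ifs <;> norm_num
  have hℓ1 : ∀ c : PBond (F.P J) 0, ∑ X ∈ Finset.univ.filter (fun X => c ∈ X), (if X = Finset.univ then (1 : ℝ) else 0) ≤ 1 := fun c => by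
    rw [Finset.sum_ite_eq']; split_ifs <;> norm_num
  have hh2 : ∀ c c' : PBond (F.P J) 0,
      ∑ X ∈ Finset.univ.filter (fun X => c ∈ X ∧ c' ∈ X), (fun _ : Finset (PBond (F.P J) 0) => (0 : ℝ)) X ≤
        0 * Real.exp (-(2 * 1 * (κ / 4 * (c.src.tdist c'.src : ℝ)))) := fun c c' => by simp
  have hC11' : ∀ (X : Finset (PBond (F.P J) 0)) (U V W Z : GaugeField (F.P J) 0 (Matrix.specialUnitaryGroup (Fin 2) ℂ))
      (S₁ S₂ S₁₂ : PBond (F.P J) 0 → ℝ), (∀ e', blk e' ∈ X → ‖M U e' - M W e' - M V e' + M Z e'‖ ≤ S₁₂ (blk e')) →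
      |T' X (M U) - T' X (M W) - T' X (M V) + T' X (M Z)| ≤
        (fun _ : Finset (PBond (F.P J) 0) => (0 : ℝ)) X * (∑ c ∈ X, S₁ c) * (∑ c ∈ X, S₂ c) +
          (if X = Finset.univ then (1 : ℝ) else 0) * ∑ c ∈ X, S₁₂ c := fun X U V W Z S₁ S₂ S₁₂ h12 => by
    simpa only [zero_mul, zero_add] using hC11 X (M U) (M W) (M V) (M Z) S₁₂ h12
  have hrep' : ∀ U : GaugeField (F.P J) 0 (Matrix.specialUnitaryGroup (Fin 2) ℂ), PlaqSmall (θBal F.L γ b₀ p₀ J) U →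
      Real.log (ρ U) + (F.scheme ℰp γ).β K * minActionRegPr F J K hJK ε₀ U = c₀ + T ∅ (fun _ => 1) + ∑ X, T' X (M U) := fun U hU => by
    rw [hv U hU, hrep U, hi ∅ U (fun _ => 1) fun e' he' => (Finset.notMem_empty e' he').elim]
    ring
  exact ⟨c₀ + T ∅ (fun _ => 1), fun b b' => κ / 4 * (b.src.tdist b'.src : ℝ), blk, M, T',
    fun X => if X = Finset.univ then (1 : ℝ) else 0, fun _ => 0,
    hd0, hdsymm, hdtri, hdsum, hdcmp, hℓ0, fun _ => le_rfl, hℓ1, hh2,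
    fun X U V _ _ S₁ _ hS => hLip X (M U) (M V) S₁ hS,
    fun X U V W Z _ _ _ _ S₁ S₂ S₁₂ _ _ _ _ _ h12 => hC11' X U V W Z S₁ S₂ S₁₂ h12,
    fun b U V hU hV hUV e' => hR1 b U V hU hV hUV e',
    fun b b' U V W Z hU hV hW hZ h₁ h₂ h₃ h₄ e' => hR2 b b' U V W Z hU hV hW hZ h₁ h₂ h₃ h₄ e', hrep'⟩

end Summit.QuantumFields.YangMills.Theorems.FluctuationComparisonRegPrIntLBackgroundFormCellOfPolymer

end
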